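import Summits.Ventures.PercRepro.C025ProfileGirthRowsAll
import Summits.Ventures.PercRepro.RankLevelSetUpTo2

/-!
# C-025 AND EVERY ROW OF (Π) ON EVERY FINITE PAVING MATROID (night-3 g21)

A finite matroid is PAVING when every circuit has at least `ρ(E)` points (`∀ C, M.IsCircuit C → M.eRank ≤ C.encard`;
uniform matroids and sparse paving matroids are paving).  Paving is the girth condition of the companion module
`C025ProfileGirthRowsAll` taken for EVERY `q` at once: for `q < ρ(E)` every set of at most `q` points is independent
(`girth_of_paving`), and for `q ≥ ρ(E)` the level `q < ρ(A) < p` is empty, so the inequality is `0 ≤ 0`.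
* `indep_of_encard_le_of_circuits` — every set of `≤ q < r` points is independent when every circuit has `≥ r` points;
* `girth_of_paving` — the girth hypothesis of `rls_of_girth_all_rows` at every `q < ρ(E)` of a paving matroid;
* `rls_of_le_succ` — `ThmN.RLS M p q` is trivial for `p ≤ q + 1` (`Φ(p, q) = 0`);
* **`rls_of_paving (hpav) (p q) : ThmN.RLS M p q`** — C-025 at EVERY `(p, q)` on every finite paving matroid
  (`q = 0` is p3's `c025_of_q_zero`; `1 ≤ q < ρ(E)` the girth theorem; `q ≥ ρ(E)` the empty level);
* **`profileIneq_of_paving (hpav) (q u) (hq : 1 ≤ q) (hqu : q < u) : Profile.ProfileIneq M q u`** — every row of (Π)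
  (C-032) on every finite paving matroid;
* **`c025_of_paving`** — the body of `C025` restricted to paving matroids, in `C025`'s own binders.
No `def`, no `instance`, no notation.  Axioms: standard.
-/

open scoped Matroid

namespace PercRepro

open Set Finset

namespace PavingRows

variable {α : Type} {M : Matroid α}

/-- If every circuit of `M` has at least `r` points, then every subset of the ground set with at most `q < r`
points is independent (girth `≥ r` gives girth `≥ q + 1`). -/
theorem indep_of_encard_le_of_circuits {r q : ℕ} (hr : ∀ C, M.IsCircuit C → (r : ℕ∞) ≤ C.encard) (hqr : q < r) :
    ∀ T ⊆ M.E, T.encard ≤ (q : ℕ∞) → M.Indep T := by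
  intro T hT hTq
  by_contra hind
  obtain ⟨C, hCT, hC⟩ := ((Matroid.not_indep_iff hT).1 hind).exists_isCircuit_subset
  have h1 : (r : ℕ∞) ≤ (q : ℕ∞) := (hr C hC).trans ((Set.encard_le_encard hCT).trans hTq)
  have h2 : r ≤ q := by exact_mod_cast h1
  omega

/-- In a paving matroid (every circuit has at least `ρ(E)` points) every set of at most `q < ρ(E)` points is
independent: the girth hypothesis of the companion module at every `q` below the rank. -/
theorem girth_of_paving (hpav : ∀ C, M.IsCircuit C → M.eRank ≤ C.encard) {q : ℕ} (hq : (q : ℕ∞) < M.eRank) :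
    ∀ T ⊆ M.E, T.encard ≤ (q : ℕ∞) → M.Indep T := by
  intro T hT hTq
  by_contra hind
  obtain ⟨C, hCT, hC⟩ := ((Matroid.not_indep_iff hT).1 hind).exists_isCircuit_subset
  exact absurd ((hpav C hC).trans ((Set.encard_le_encard hCT).trans hTq)) (not_le.2 hq)

variable [M.Finite]

/-- `ThmN.RLS M p q` is trivial when `p ≤ q + 1`: `Φ(p, q)` is an empty sum. -/
theorem rls_of_le_succ (p q : ℕ) (hpq : p ≤ q + 1) : ThmN.RLS M p q := by
  unfold ThmN.RLS
  have h0 : phiK p q = 0 := by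
    unfold phiK
    rw [Finset.sum_eq_zero, zero_div]
    intro u hu
    rw [Finset.mem_Ioo] at hu
    omega
  rw [h0, zero_mul]
  exact Nat.cast_nonneg _

/-- **C-025 at every `(p, q)` on every finite paving matroid.**  For `q = 0` this is p3's `c025_of_q_zero`; for
`1 ≤ q < ρ(E)` every set of at most `q` points is independent and the girth theorem `rls_of_girth_all_rows`
applies; for `ρ(E) ≤ q` the statement is trivial (`Φ = 0` when `p ≤ q + 1`, no set of rank `p > q ≥ ρ(E)` otherwise). -/
theorem rls_of_paving [DecidableEq α] (hpav : ∀ C, M.IsCircuit C → M.eRank ≤ C.encard) (p q : ℕ) :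
    ThmN.RLS M p q := by
  rcases Nat.eq_zero_or_pos q with rfl | hq
  · exact c025_of_q_zero p
  by_cases hqr : (q : ℕ∞) < M.eRank
  · exact GirthRows.rls_of_girth_all_rows p q hq (girth_of_paving hpav hqr)
  · rw [not_lt] at hqr
    by_cases hp : p ≤ q + 1
    · exact rls_of_le_succ p q hp
    · apply ThmN.RLS_of_eRank_lt
      calc M.eRank ≤ (q : ℕ∞) := hqr
        _ < (p : ℕ∞) := by exact_mod_cast (by omega : q < p)

/-- **Every row `(q, u)` of (Π) on every finite paving matroid**, `1 ≤ q < u`: below the rank by the girth theorem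
`profileIneq_of_girth_all_rows`, at or above the rank every price is `0`. -/
theorem profileIneq_of_paving [DecidableEq α] (hpav : ∀ C, M.IsCircuit C → M.eRank ≤ C.encard) (q u : ℕ)
    (hq : 1 ≤ q) (hqu : q < u) : Profile.ProfileIneq M q u := by
  by_cases hqr : (q : ℕ∞) < M.eRank
  · exact GirthRows.profileIneq_of_girth_all_rows q u hq hqu (girth_of_paving hpav hqr)
  · rw [not_lt] at hqr
    apply GirthRows.profileIneq_of_eRank_lt
    calc M.eRank ≤ (q : ℕ∞) := hqr
      _ < (u : ℕ∞) := by exact_mod_cast hqu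

end PavingRows

/-- **The body of `C025` on every finite paving matroid** (every circuit has at least `ρ(E)` points), in the binders
of `C025` itself: for all `p > q ≥ 0` with `p − q ≥ 2`,
`Φ(p, q) · #{A ⊆ E : ρ(A) = p, ρ(E ∖ A) = q} ≤ #{A ⊆ E : q < ρ(A) < p}`. -/
theorem c025_of_paving :
    ∀ {α : Type} (M : Matroid α) [M.Finite], (∀ C, M.IsCircuit C → M.eRank ≤ C.encard) → ∀ (p q : ℕ), q + 2 ≤ p →
      phiK p q * ({A : Set α | A ⊆ M.E ∧ M.eRk A = (p : ℕ∞) ∧ M.eRk (M.E \ A) = (q : ℕ∞)}.ncard : ℚ) ≤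
        ({A : Set α | A ⊆ M.E ∧ (q : ℕ∞) < M.eRk A ∧ M.eRk A < (p : ℕ∞)}.ncard : ℚ) := by
  intro α M _ hpav p q _
  classical
  exact PavingRows.rls_of_paving hpav p q

end PercRepro
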